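import Summits.NavierStokesRegularity.NavierStokesRegularity.Theorems.ExtremiserTransienceNearExtremalTransienceExtremiserLiouvilleConstantSpeedGlobalVariation
import Literature.Analysis.FunctionSpaces.BesovSliceMeasurability
import Literature.Geometry.Riemannian.ExpMapEnergyTaylor
import HarnessLib

/-!
# Crux `ExtremiserTransience.NearExtremalTransience` (stmt-NavierStokesRegularity-21883), line `extremiser_liouville`,
# stub K1b — TRANSLATION TOOLKIT for the `h → 0` limit of the discrete slide (blueprint L4, tools)

`--supports stmt-NavierStokesRegularity-21883` (helper).  Author: prover seat `ns-el-k1b` (g8).  Record: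
`Cruxes/NearExtremalTransience/Lines/extremiser_liouville_k1b_slide.md` §11 (L4).

After `slideKKT` (`ℓ(φ̂_h) ≥ 0` for the discrete slide direction `φ̂_h`, all `h ≥ 0`), the slide inequality (INEQ) is the
limit `h → 0⁺` of `h⁻¹ℓ(φ̂_h)`.  Every term of `h⁻¹ℓ(φ̂_h)` is a pairing of a FIXED `L²` quantity built from `v` with a
vertical translate `F(· − he₂)`, a backward difference quotient `h⁻¹(F − F(· − he₂))` or a sliding average of an `L²`/`H¹`
quantity built from `V, DV, D²V`.  This file supplies the two convergence facts that drive all these limits: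
* `tendsto_lintegral_translate_sub` : **continuity of translation in `L²(ℝ³)`**, `∫‖F(· + a) − F‖² → 0` (`a → 0`), for
  `F ∈ L²` (from the tree's `continuous_eLpNorm_comp_add_sub`, Rudin Thm. 9.5);
* `lintegral_backwardQuotient_sub_fderiv_le` and `tendsto_lintegral_backwardQuotient_sub_fderiv` : **the backward
  difference quotient converges to `∂₂F` in `L²`**, `∫‖h⁻¹(F − F(· − he₂)) − ∂₂F‖² → 0` (`h → 0⁺`), for `F ∈ C¹` with
  `∂₂F ∈ L²` (FTC along `e₂`, Cauchy–Schwarz on `[−h,0]`, Tonelli, and the first fact) — no second derivative of `F` is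
  used, which is the point (`F = Dω` has `∂₂F = D²ω ∉ L²` a priori; the lemma is applied to `F ∈ {V, DV, ω}`).
Pairings then converge by `Literature.Analysis.FluidPDE.abs_integral_inner_le_sqrt_mul_sqrt`.

WHAT THIS IS NOT: K1b is NOT proved; nothing here proves NS regularity. [folklore]
-/

noncomputable section

open Set Filter Topology MeasureTheory Metric Function InnerProductSpace
open scoped ENNReal NNReal Topology InnerProductSpace RealInnerProductSpace ContDiff
open Literature.Analysis.FluidPDE Literature.Analysis

namespace Summit.NavierStokesRegularity.NavierStokesRegularity.Theorems

-- the problem directory repeats the summit name (`NavierStokesRegularity/NavierStokesRegularity`)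
set_option linter.dupNamespace false

namespace ExtremiserLiouville

open DepletionLadder.KStar

variable {F' : Type*} [NormedAddCommGroup F'] [NormedSpace ℝ F']

/-! ## 1. Continuity of translation in `L²(ℝ³)` -/

omit [NormedSpace ℝ F'] in
/-- `∫⁻‖f‖ₑ² = ‖f‖_{L²}²`. [folklore] -/
theorem lintegral_enorm_sq_eq_eLpNorm_sq (f : EuclideanSpace ℝ (Fin 3) → F') :
    ∫⁻ x, ‖f x‖ₑ ^ 2 = eLpNorm f 2 (volume : Measure (EuclideanSpace ℝ (Fin 3))) ^ 2 := by
  rw [eLpNorm_eq_lintegral_rpow_enorm_toReal two_ne_zero ENNReal.ofNat_ne_top, ENNReal.toReal_ofNat,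
    ← ENNReal.rpow_natCast, ← ENNReal.rpow_mul]
  norm_num

omit [NormedSpace ℝ F'] in
/-- **Continuity of translation in `L²(ℝ³)`**: `∫‖F(· + a) − F‖² → 0` as `a → 0`, for `F ∈ L²`. [folklore] -/
theorem tendsto_lintegral_translate_sub {F : EuclideanSpace ℝ (Fin 3) → F'}
    (hF : MemLp F 2 (volume : Measure (EuclideanSpace ℝ (Fin 3)))) :
    Tendsto (fun a : EuclideanSpace ℝ (Fin 3) => ∫⁻ x, ‖F (x + a) - F x‖ₑ ^ 2) (𝓝 0) (𝓝 0) := by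
  have hc := Literature.Analysis.FunctionSpaces.continuous_eLpNorm_comp_add_sub (μ := (volume : Measure (EuclideanSpace ℝ (Fin 3))))
    (p := 2) (by norm_num) ENNReal.ofNat_ne_top hF
  have h0 : eLpNorm (fun x => F (x + 0) - F x) 2 (volume : Measure (EuclideanSpace ℝ (Fin 3))) = 0 := by simp
  have ht : Tendsto (fun a : EuclideanSpace ℝ (Fin 3) => eLpNorm (fun x => F (x + a) - F x) 2
      (volume : Measure (EuclideanSpace ℝ (Fin 3))) ^ 2) (𝓝 0) (𝓝 0) := by
    have h := ((ENNReal.continuous_pow 2).tendsto _).comp (hc.tendsto 0)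
    rw [h0, zero_pow two_ne_zero] at h
    exact h
  refine ht.congr fun a => ?_
  rw [lintegral_enorm_sq_eq_eLpNorm_sq]

omit [NormedSpace ℝ F'] in
/-- `ε`-form along the axis: for `F ∈ L²` and `ε > 0` there is `δ > 0` with `∫‖F(· + te₂) − F‖² ≤ ε` for `|t| < δ`. [folklore] -/
theorem exists_delta_lintegral_translate_axis_le {F : EuclideanSpace ℝ (Fin 3) → F'}
    (hF : MemLp F 2 (volume : Measure (EuclideanSpace ℝ (Fin 3)))) {ε : ℝ≥0∞} (hε : 0 < ε) :
    ∃ δ : ℝ, 0 < δ ∧ ∀ t : ℝ, |t| < δ →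
      ∫⁻ x, ‖F (x + t • EuclideanSpace.single (2 : Fin 3) (1 : ℝ)) - F x‖ₑ ^ 2 ≤ ε := by
  have h := tendsto_lintegral_translate_sub hF
  have hev : ∀ᶠ a : EuclideanSpace ℝ (Fin 3) in 𝓝 0, ∫⁻ x, ‖F (x + a) - F x‖ₑ ^ 2 ≤ ε :=
    (ENNReal.tendsto_nhds_zero.1 h) ε hε
  obtain ⟨δ, hδ, hball⟩ := Metric.eventually_nhds_iff.1 hev
  refine ⟨δ, hδ, fun t ht => hball ?_⟩
  rw [dist_zero_right, norm_smul, PiLp.norm_single, norm_one, mul_one, Real.norm_eq_abs]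
  exact ht

/-! ## 2. The backward difference quotient converges to `∂₂F` in `L²` -/

/-- Segments of a `C¹` map: `t ↦ F(x + te₂)` has derivative `∂₂F(x + te₂)`. [folklore] -/
theorem hasDerivAt_comp_add_smul_axis {F : EuclideanSpace ℝ (Fin 3) → F'} (hF : Differentiable ℝ F)
    (x : EuclideanSpace ℝ (Fin 3)) (t : ℝ) :
    HasDerivAt (fun t : ℝ => F (x + t • EuclideanSpace.single (2 : Fin 3) (1 : ℝ)))
      (fderiv ℝ F (x + t • EuclideanSpace.single (2 : Fin 3) (1 : ℝ)) (EuclideanSpace.single (2 : Fin 3) (1 : ℝ))) t := by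
  set e₂ : EuclideanSpace ℝ (Fin 3) := EuclideanSpace.single (2 : Fin 3) (1 : ℝ) with he₂
  have hl : HasDerivAt (fun t : ℝ => x + t • e₂) ((1 : ℝ) • e₂) t := ((hasDerivAt_id t).smul_const e₂).const_add x
  rw [one_smul] at hl
  exact (hF (x + t • e₂)).hasFDerivAt.comp_hasDerivAt t hl

/-- **Pointwise step**: for `F ∈ C¹` and `h > 0`,
`‖h⁻¹(F(x) − F(x − he₂)) − ∂₂F(x)‖² ≤ h⁻¹∫_{−h}^{0}‖∂₂F(x + te₂) − ∂₂F(x)‖²dt`. [folklore] -/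
theorem norm_backwardQuotient_sub_fderiv_sq_le [CompleteSpace F'] {F : EuclideanSpace ℝ (Fin 3) → F'} (hF : ContDiff ℝ 1 F)
    {h : ℝ} (hh : 0 < h) (x : EuclideanSpace ℝ (Fin 3)) :
    ‖h⁻¹ • (F x - F (x + (-h) • EuclideanSpace.single (2 : Fin 3) (1 : ℝ))) -
        fderiv ℝ F x (EuclideanSpace.single (2 : Fin 3) (1 : ℝ))‖ ^ 2 ≤
      h⁻¹ * ∫ t in (-h)..0, ‖fderiv ℝ F (x + t • EuclideanSpace.single (2 : Fin 3) (1 : ℝ)) (EuclideanSpace.single (2 : Fin 3) (1 : ℝ)) -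
        fderiv ℝ F x (EuclideanSpace.single (2 : Fin 3) (1 : ℝ))‖ ^ 2 := by
  set e₂ : EuclideanSpace ℝ (Fin 3) := EuclideanSpace.single (2 : Fin 3) (1 : ℝ) with he₂
  have hFd : Differentiable ℝ F := hF.differentiable one_ne_zero
  set c' : ℝ → F' := fun t => fderiv ℝ F (x + t • e₂) e₂ with hc'
  have hc'c : Continuous c' :=
    ((hF.continuous_fderiv one_ne_zero).comp (continuous_const.add (continuous_id.smul continuous_const))).clm_apply
      continuous_const
  -- FTC along the segment
  have hftc : ∫ t in (-h)..0, c' t = F x - F (x + (-h) • e₂) := by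
    have h1 := intervalIntegral.integral_eq_sub_of_hasDerivAt (a := -h) (b := 0) (f := fun t : ℝ => F (x + t • e₂)) (f' := c')
      (fun t _ => hasDerivAt_comp_add_smul_axis hFd x t) (hc'c.intervalIntegrable _ _)
    simpa using h1
  set d : F' := fderiv ℝ F x e₂ with hd
  have hconst : ∫ _t in (-h)..0, d = h • d := by
    rw [intervalIntegral.integral_const]; simp
  -- the difference as an average
  have hdiff : h⁻¹ • (F x - F (x + (-h) • e₂)) - d = h⁻¹ • ∫ t in (-h)..0, (c' t - d) := by
    rw [intervalIntegral.integral_sub (hc'c.intervalIntegrable _ _) intervalIntegrable_const, hftc, hconst]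
    conv_rhs => rw [smul_sub, smul_smul, inv_mul_cancel₀ hh.ne', one_smul]
  rw [hdiff, norm_smul, mul_pow, Real.norm_eq_abs, abs_of_pos (inv_pos.2 hh)]
  -- Cauchy–Schwarz on `[−h, 0]`
  have hφ : Continuous fun t => ‖c' t - d‖ := (hc'c.sub continuous_const).norm
  have hcs := Literature.Geometry.Riemannian.sq_intervalIntegral_le_length_mul_of_continuous hφ (neg_nonpos.2 hh.le)
  simp only [sub_neg_eq_add, zero_add] at hcs
  have hn : ‖∫ t in (-h)..0, (c' t - d)‖ ≤ ∫ t in (-h)..0, ‖c' t - d‖ :=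
    intervalIntegral.norm_integral_le_integral_norm (neg_nonpos.2 hh.le)
  calc h⁻¹ ^ 2 * ‖∫ t in (-h)..0, (c' t - d)‖ ^ 2
      ≤ h⁻¹ ^ 2 * (∫ t in (-h)..0, ‖c' t - d‖) ^ 2 := by
        gcongr
    _ ≤ h⁻¹ ^ 2 * (h * ∫ t in (-h)..0, ‖c' t - d‖ ^ 2) := mul_le_mul_of_nonneg_left hcs (sq_nonneg _)
    _ = h⁻¹ * ∫ t in (-h)..0, ‖c' t - d‖ ^ 2 := by field_simp

/-- **`L²` bound for the backward difference quotient**: for `F ∈ C¹` and `h > 0`,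
`∫‖h⁻¹(F − F(· − he₂)) − ∂₂F‖² ≤ h⁻¹ ∫_{t ∈ (−h,0]} ∫‖∂₂F(· + te₂) − ∂₂F‖² dt` (Tonelli). [folklore] -/
theorem lintegral_backwardQuotient_sub_fderiv_le [CompleteSpace F'] {F : EuclideanSpace ℝ (Fin 3) → F'} (hF : ContDiff ℝ 1 F)
    {h : ℝ} (hh : 0 < h) :
    ∫⁻ x, ‖h⁻¹ • (F x - F (x + (-h) • EuclideanSpace.single (2 : Fin 3) (1 : ℝ))) -
        fderiv ℝ F x (EuclideanSpace.single (2 : Fin 3) (1 : ℝ))‖ₑ ^ 2 ≤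
      ENNReal.ofReal h⁻¹ * ∫⁻ t in Ioc (-h) 0, ∫⁻ x,
        ‖fderiv ℝ F (x + t • EuclideanSpace.single (2 : Fin 3) (1 : ℝ)) (EuclideanSpace.single (2 : Fin 3) (1 : ℝ)) -
          fderiv ℝ F x (EuclideanSpace.single (2 : Fin 3) (1 : ℝ))‖ₑ ^ 2 := by
  set e₂ : EuclideanSpace ℝ (Fin 3) := EuclideanSpace.single (2 : Fin 3) (1 : ℝ) with he₂
  have cD : Continuous fun p : EuclideanSpace ℝ (Fin 3) × ℝ => fderiv ℝ F (p.1 + p.2 • e₂) e₂ - fderiv ℝ F p.1 e₂ :=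
    (((hF.continuous_fderiv one_ne_zero).comp (continuous_fst.add (continuous_snd.smul continuous_const))).clm_apply
      continuous_const).sub (((hF.continuous_fderiv one_ne_zero).comp continuous_fst).clm_apply continuous_const)
  set Φ : EuclideanSpace ℝ (Fin 3) → ℝ → ℝ≥0∞ := fun x t => ‖fderiv ℝ F (x + t • e₂) e₂ - fderiv ℝ F x e₂‖ₑ ^ 2 with hΦ
  have hΦm : AEMeasurable (uncurry Φ) ((volume : Measure (EuclideanSpace ℝ (Fin 3))).prod
      ((volume : Measure ℝ).restrict (Ioc (-h) 0))) :=
    ((ENNReal.continuous_pow 2).comp cD.enorm).measurable.aemeasurable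
  have hstep : ∀ x, ‖h⁻¹ • (F x - F (x + (-h) • e₂)) - fderiv ℝ F x e₂‖ₑ ^ 2 ≤
      ENNReal.ofReal h⁻¹ * ∫⁻ t in Ioc (-h) 0, Φ x t := by
    intro x
    have hc : Continuous fun t : ℝ => ‖fderiv ℝ F (x + t • e₂) e₂ - fderiv ℝ F x e₂‖ ^ 2 :=
      ((cD.comp (Continuous.prodMk_right x)).norm.pow 2)
    have hi : IntegrableOn (fun t : ℝ => ‖fderiv ℝ F (x + t • e₂) e₂ - fderiv ℝ F x e₂‖ ^ 2) (Ioc (-h) 0) volume :=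
      (hc.integrableOn_Icc (a := -h) (b := 0)).mono_set Ioc_subset_Icc_self
    rw [← ofReal_norm, ← ENNReal.ofReal_pow (norm_nonneg _)]
    calc ENNReal.ofReal (‖h⁻¹ • (F x - F (x + (-h) • e₂)) - fderiv ℝ F x e₂‖ ^ 2)
        ≤ ENNReal.ofReal (h⁻¹ * ∫ t in (-h)..0, ‖fderiv ℝ F (x + t • e₂) e₂ - fderiv ℝ F x e₂‖ ^ 2) :=
          ENNReal.ofReal_le_ofReal (norm_backwardQuotient_sub_fderiv_sq_le hF hh x)
      _ = ENNReal.ofReal h⁻¹ * ∫⁻ t in Ioc (-h) 0, Φ x t := by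
          rw [ENNReal.ofReal_mul (inv_nonneg.2 hh.le), intervalIntegral.integral_of_le (neg_nonpos.2 hh.le),
            ofReal_integral_eq_lintegral_ofReal hi (Eventually.of_forall fun t => sq_nonneg _)]
          congr 1
          refine setLIntegral_congr_fun measurableSet_Ioc fun t _ => ?_
          simp only [hΦ]
          rw [ENNReal.ofReal_pow (norm_nonneg _), ofReal_norm]
  calc ∫⁻ x, ‖h⁻¹ • (F x - F (x + (-h) • e₂)) - fderiv ℝ F x e₂‖ₑ ^ 2
      ≤ ∫⁻ x, ENNReal.ofReal h⁻¹ * ∫⁻ t in Ioc (-h) 0, Φ x t := lintegral_mono hstep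
    _ = ENNReal.ofReal h⁻¹ * ∫⁻ x, ∫⁻ t in Ioc (-h) 0, Φ x t := by rw [lintegral_const_mul' _ _ ENNReal.ofReal_ne_top]
    _ = ENNReal.ofReal h⁻¹ * ∫⁻ t in Ioc (-h) 0, ∫⁻ x, Φ x t := by rw [lintegral_lintegral_swap hΦm]

/-- **The backward difference quotient converges to `∂₂F` in `L²`**: for `F ∈ C¹` with `∂₂F ∈ L²`,
`∫‖h⁻¹(F − F(· − he₂)) − ∂₂F‖² → 0` as `h → 0⁺`. [folklore] -/
theorem tendsto_lintegral_backwardQuotient_sub_fderiv [CompleteSpace F'] {F : EuclideanSpace ℝ (Fin 3) → F'} (hF : ContDiff ℝ 1 F)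
    (hD : MemLp (fun x => fderiv ℝ F x (EuclideanSpace.single (2 : Fin 3) (1 : ℝ))) 2
      (volume : Measure (EuclideanSpace ℝ (Fin 3)))) :
    Tendsto (fun h : ℝ => ∫⁻ x, ‖h⁻¹ • (F x - F (x + (-h) • EuclideanSpace.single (2 : Fin 3) (1 : ℝ))) -
        fderiv ℝ F x (EuclideanSpace.single (2 : Fin 3) (1 : ℝ))‖ₑ ^ 2) (𝓝[>] 0) (𝓝 0) := by
  set e₂ : EuclideanSpace ℝ (Fin 3) := EuclideanSpace.single (2 : Fin 3) (1 : ℝ) with he₂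
  refine ENNReal.tendsto_nhds_zero.2 fun ε hε => ?_
  obtain ⟨δ, hδ, hsmall⟩ := exists_delta_lintegral_translate_axis_le hD hε
  have hev : ∀ᶠ h : ℝ in 𝓝[>] 0, 0 < h ∧ h < δ := by
    have h1 : ∀ᶠ h : ℝ in 𝓝[>] 0, h < δ := by
      have : Iio δ ∈ 𝓝 (0 : ℝ) := Iio_mem_nhds hδ
      exact mem_nhdsWithin_of_mem_nhds this
    exact (eventually_mem_nhdsWithin.and h1).mono fun h hh => ⟨hh.1, hh.2⟩
  refine hev.mono fun h hh => ?_
  obtain ⟨hpos, hlt⟩ := hh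
  refine (lintegral_backwardQuotient_sub_fderiv_le hF hpos).trans ?_
  have hbound : ∀ t ∈ Ioc (-h) 0, ∫⁻ x, ‖fderiv ℝ F (x + t • e₂) e₂ - fderiv ℝ F x e₂‖ₑ ^ 2 ≤ ε := by
    intro t ht
    exact hsmall t (abs_lt.2 ⟨by linarith [ht.1], by linarith [ht.2]⟩)
  calc ENNReal.ofReal h⁻¹ * ∫⁻ t in Ioc (-h) 0, ∫⁻ x, ‖fderiv ℝ F (x + t • e₂) e₂ - fderiv ℝ F x e₂‖ₑ ^ 2
      ≤ ENNReal.ofReal h⁻¹ * ∫⁻ _t in Ioc (-h) 0, ε := mul_le_mul_right (setLIntegral_mono measurable_const hbound) _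
    _ = ENNReal.ofReal h⁻¹ * (ε * ENNReal.ofReal h) := by
        rw [setLIntegral_const, Real.volume_Ioc, sub_neg_eq_add, zero_add, mul_comm ε]
    _ = ε := by
        rw [mul_comm ε, ← mul_assoc, ← ENNReal.ofReal_mul (inv_nonneg.2 hpos.le), inv_mul_cancel₀ hpos.ne',
          ENNReal.ofReal_one, one_mul]

end ExtremiserLiouville

end Summit.NavierStokesRegularity.NavierStokesRegularity.Theorems

end
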